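import Summits.QuantumFields.BalabanUV.Beta.CombHId2TorusRecordAn1

/-!
# `BalabanUV.Beta.CombHId2TorusSocket` — binder row D1 (OWNER an2), (J-a) dictionary, (C2) at ORDER 2, PART THREE (letters, 2e): **THE CROWN AS A BLOCK EQUATION ALONG THE
# DOOR's COARSE EMBEDDING** — `(perF M′ (T2^{per,cs}_{j+1} b b′)).submatrix e e = (cE₂·wV4)•(Â·D̂_b·Â·D̂_{b′}·Â + Â·D̂_{b′}·Â·D̂_b·Â − Â·Ŵ·Â).submatrix f f + (cB·wB2)•(border).submatrix e e`
# with `e a := (ȳ a, inl (m a))` (coarse `ff` indices) and `f a := (wrapPt M (Lc•ȳ a), inr (m a))` (the fine torus' multiplier indices at the coarse points)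

WHY.  The door states `hId₂` on BLOCKS (`toBlocks₁₁` ∕ `submatrix` along an embedding `fμ : μ → Idx M (Fib 3)`, `fμ a = (wrapPt M (Lc•ȳ a), inr (m a))` —
`CombHId1Door.door_hId1_at_record`'s `hf` at order 1; leaf-05's J1 `torus_hId₂_iff_kktInv_word_comb` at order 2).  `CombHId2TorusRecord.perF_dper_tsum_T2comb_succ_inl_inl`
is the same statement ENTRYWISE; this file packages it as the `Matrix.submatrix` equation J2 consumes, for ANY index type `ι` and maps `ȳ : ι → pbox M′`, `m : ι → Fin (d+1)`
— the order-2 twin of the order-1 packaging, nothing new in content.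
WHAT ([folklore]; 0 `def`, 0 cited fact, 0 `def … : Prop`, 0 sorry): **`perF_T2comb_succ_submatrix (hM) (j) (b b′) (ȳ m)`** (generic `SymTables d Lc` record; border displayed);
**`perF_T2comb_succ_submatrix_an1 (hM) (j) (b b′) (ȳ m)`** (`d + 1 = 4`, `tabs := symTablesAn1S2 3 Lc cΛ′`: NO border term — `CombHId2TorusRecordAn1`).
NOT HERE: the torus algebra (leaf-05's J1∕J2); nothing of Bałaban's asserted; NOT D1, NEVER «G-an2-4 closed», NOT BetaPertH, NOT continuum, NOT Clay.

HONEST DEPENDENCY (page 1, mandatory): continuum YM on T⁴ ⇐ BetaPertH ∧ nine spine estimates (0/9 proved); BetaPertH ⇐ (D1) ∧ (D4) ∧ CAP+tail;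
G-an2-4 gates asym, D1 and NE2/3/4.  HONEST FRAMING (cell contract, verbatim): «discharging `BetaPertH` makes Bałaban's UV stability UNCONDITIONAL —
a real constructive-QFT result; it is NOT the continuum limit and NOT the Clay problem.»  ABSOLUTE RULE (cell charter, verbatim): «No internally-minted
statement may enter as a cited fact. Every hypothesis is either kernel-proved in this package or a verbatim quotation of a PUBLISHED theorem with page
reference. The manuscript(s) under audit are NOT citable for their own disputed steps — they are the thing under adjudication; programme-internal
(2001/route/tribunal) claims are never citable.»  Row D1 OWNER an2 (b2b-balaban-beta-an2) gen 45, 2026-08-23; over `CombHId2TorusRecord(An1)` BY NAME.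
-/

noncomputable section

open scoped BigOperators Matrix

namespace Summit.QuantumFields.BalabanUV.Beta.CombHId2TorusSocket

open Literature.MathematicalPhysics.QuantumFieldTheory.Balaban1983to89
open Literature.MathematicalPhysics.QuantumFieldTheory.Balaban1983to89.Beta
open B4TorusKernel.MultiPeriod (translate)
open AffineAveraging (Site)
open OneStepResolventKernel (Fib)
open BalabanStepW2 (wV4 wB2 M2Of)
open SecondOrderResponse (dM W2SymOfK)
open Summit.QuantumFields.BalabanUV.Beta.SpineRooted (T2RecOf)
open Summit.QuantumFields.BalabanUV.Beta.FP.KernelPeriodisationFib (Idx perF)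
open Summit.QuantumFields.BalabanUV.Beta.FP.KernelPeriodisationFibLoc (dper)
open Summit.QuantumFields.BalabanUV.Beta.FP.TorusGaugeCovariancePairing (wrapPt)
open Summit.QuantumFields.BalabanUV.Beta.SymmetrisedStepJets (SymTables)
open Summit.QuantumFields.BalabanUV.Beta.SymSecondOrderTablesAn1 (symTablesAn1S2)
open Summit.QuantumFields.BalabanUV.Beta.CombChartStepJets (GcombSh SpureCombOf)
open B6Lemma24Torus (pbox)
open Summit.QuantumFields.BalabanUV.Beta.CombHId2TorusRecord (perF_dper_tsum_T2comb_succ_inl_inl)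
open Summit.QuantumFields.BalabanUV.Beta.CombHId2TorusRecordAn1 (perF_dper_tsum_T2comb_succ_inl_inl_an1)

/-! ## §1 The crown along a coarse embedding (generic record) -/

section Generic

variable {d : ℕ} (M : Fin (d + 1) → ℕ) [∀ μ, NeZero (M μ)] {Lc : ℕ} [NeZero Lc] {M' : Fin (d + 1) → ℕ} [∀ μ, NeZero (M' μ)]
  (tabs : SymTables d Lc) (cE cVH cΛ cE₂ cB : ℝ) (T : Fin 4 → Fin 4 → Fin 4 → Fin 4 → ℝ)

/-- [folklore] **THE CROWN AS A BLOCK EQUATION**: for any index type `ι` and maps `ȳ : ι → pbox M′`, `m : ι → Fin (d+1)`, with `e a := (ȳ a, inl (m a))` and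
`f a := (wrapPt M (Lc•ȳ a), inr (m a))`,
`(perF M′ (T2^{per,cs}_{j+1} μ y ν y′)).submatrix e e = (cE₂·wV4 (j+1)) • (Â·D̂_{μy}·Â·D̂_{νy′}·Â + Â·D̂_{νy′}·Â·D̂_{μy}·Â − Â·Ŵ·Â).submatrix f f + (cB·wB2 (j+1)) • (perF M′ (vh₂S^{per,cs}_{μy,νy′})).submatrix e e`
(`CombHId2TorusRecord.perF_dper_tsum_T2comb_succ_inl_inl` entrywise, `Matrix.ext`). -/
theorem perF_T2comb_succ_submatrix (hM : ∀ i, M i = Lc * M' i) (j : ℕ) (μ : Fin (d + 1)) (y : Site (d + 1)) (ν : Fin (d + 1)) (y' : Site (d + 1))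
    {ι : Type*} (ybar : ι → ↥(pbox M')) (m : ι → Fin (d + 1)) :
    (perF M' (dper M' (fun x z a b => ∑' n, T2RecOf d Lc (GcombSh Lc) (SpureCombOf tabs cE cVH cΛ) tabs.M cE₂ cB T tabs.vh₂S tabs.mixFF (j + 1) μ y ν
        (translate M' y' n) x z a b))).submatrix (fun a : ι => ((ybar a, Sum.inl (m a)) : Idx M' (Fib d))) (fun a : ι => ((ybar a, Sum.inl (m a)) : Idx M' (Fib d)))
      = (cE₂ * wV4 d Lc (j + 1))
          • (perF M (GcombSh (d := d) Lc j)
              * perF M (dM (GcombSh (d := d) Lc j) Lc (fun κ u => dper M (SpureCombOf tabs cE cVH cΛ j κ u)) (fun ρ w => dper M (tabs.M j ρ w)) μ y)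
              * perF M (GcombSh (d := d) Lc j)
              * perF M (dM (GcombSh (d := d) Lc j) Lc (fun κ u => dper M (SpureCombOf tabs cE cVH cΛ j κ u)) (fun ρ w => dper M (tabs.M j ρ w)) ν y')
              * perF M (GcombSh (d := d) Lc j)
            + perF M (GcombSh (d := d) Lc j)
              * perF M (dM (GcombSh (d := d) Lc j) Lc (fun κ u => dper M (SpureCombOf tabs cE cVH cΛ j κ u)) (fun ρ w => dper M (tabs.M j ρ w)) ν y')
              * perF M (GcombSh (d := d) Lc j)
              * perF M (dM (GcombSh (d := d) Lc j) Lc (fun κ u => dper M (SpureCombOf tabs cE cVH cΛ j κ u)) (fun ρ w => dper M (tabs.M j ρ w)) μ y)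
              * perF M (GcombSh (d := d) Lc j)
            - perF M (GcombSh (d := d) Lc j)
              * perF M (W2SymOfK (GcombSh (d := d) Lc j) Lc (fun κ u => dper M (SpureCombOf tabs cE cVH cΛ j κ u)) (fun ρ w => dper M (tabs.M j ρ w))
                  (fun κ u κ' u' => dper M (fun x z a c => ∑' n : Site (d + 1),
                    T2RecOf d Lc (GcombSh Lc) (SpureCombOf tabs cE cVH cΛ) tabs.M cE₂ cB T tabs.vh₂S tabs.mixFF j κ u κ' (translate M u' n) x z a c))
                  (fun κ u ρ w => dper M (fun x z a c => ∑' n : Site (d + 1), M2Of d Lc tabs.mixFF j κ u ρ (translate M' w n) x z a c)) μ y ν y')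
              * perF M (GcombSh (d := d) Lc j)).submatrix
            (fun a : ι => ((wrapPt M ((Lc : ℤ) • (ybar a : Site (d + 1))), Sum.inr (m a)) : Idx M (Fib d)))
            (fun a : ι => ((wrapPt M ((Lc : ℤ) • (ybar a : Site (d + 1))), Sum.inr (m a)) : Idx M (Fib d)))
        + (cB * wB2 d Lc (j + 1))
          • (perF M' (dper M' (fun x z a b => ∑' n, tabs.vh₂S μ y ν (translate M' y' n) x z a b))).submatrix
              (fun a : ι => ((ybar a, Sum.inl (m a)) : Idx M' (Fib d))) (fun a : ι => ((ybar a, Sum.inl (m a)) : Idx M' (Fib d))) := by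
  ext a a'
  simp only [Matrix.submatrix_apply, Matrix.add_apply, Matrix.smul_apply, smul_eq_mul]
  exact perF_dper_tsum_T2comb_succ_inl_inl M tabs cE cVH cΛ cE₂ cB T hM j μ y ν y' (ybar a) (ybar a') (m a) (m a')

end Generic

/-! ## §2 The crown along a coarse embedding at an1's four-dimensional record: no border term -/

section An1Record

variable (M : Fin (3 + 1) → ℕ) [∀ μ, NeZero (M μ)] {Lc : ℕ} [NeZero Lc] {M' : Fin (3 + 1) → ℕ} [∀ μ, NeZero (M' μ)]
  (cΛ' cE cVH cΛ cE₂ cB : ℝ) (T : Fin 4 → Fin 4 → Fin 4 → Fin 4 → ℝ)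

/-- [folklore] **THE CROWN AS A BLOCK EQUATION AT an1's 4D RECORD — NO BORDER TERM** (`tabs := symTablesAn1S2 3 Lc cΛ′`):
`(perF M′ (T2^{per,cs}_{j+1} μ y ν y′)).submatrix e e = (cE₂·wV4 3 Lc (j+1)) • (Â·D̂_{μy}·Â·D̂_{νy′}·Â + Â·D̂_{νy′}·Â·D̂_{μy}·Â − Â·Ŵ·Â).submatrix f f`
(`CombHId2TorusRecordAn1.perF_dper_tsum_T2comb_succ_inl_inl_an1` entrywise). -/
theorem perF_T2comb_succ_submatrix_an1 (hM : ∀ i, M i = Lc * M' i) (j : ℕ) (μ : Fin (3 + 1)) (y : Site (3 + 1)) (ν : Fin (3 + 1)) (y' : Site (3 + 1))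
    {ι : Type*} (ybar : ι → ↥(pbox M')) (m : ι → Fin (3 + 1)) :
    (perF M' (dper M' (fun x z a b => ∑' n, T2RecOf 3 Lc (GcombSh Lc) (SpureCombOf (symTablesAn1S2 3 Lc cΛ') cE cVH cΛ) (symTablesAn1S2 3 Lc cΛ').M cE₂ cB T
        (symTablesAn1S2 3 Lc cΛ').vh₂S (symTablesAn1S2 3 Lc cΛ').mixFF (j + 1) μ y ν (translate M' y' n) x z a b))).submatrix
        (fun a : ι => ((ybar a, Sum.inl (m a)) : Idx M' (Fib 3))) (fun a : ι => ((ybar a, Sum.inl (m a)) : Idx M' (Fib 3)))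
      = (cE₂ * wV4 3 Lc (j + 1))
          • (perF M (GcombSh (d := 3) Lc j)
              * perF M (dM (GcombSh (d := 3) Lc j) Lc (fun κ u => dper M (SpureCombOf (symTablesAn1S2 3 Lc cΛ') cE cVH cΛ j κ u))
                  (fun ρ w => dper M ((symTablesAn1S2 3 Lc cΛ').M j ρ w)) μ y)
              * perF M (GcombSh (d := 3) Lc j)
              * perF M (dM (GcombSh (d := 3) Lc j) Lc (fun κ u => dper M (SpureCombOf (symTablesAn1S2 3 Lc cΛ') cE cVH cΛ j κ u))
                  (fun ρ w => dper M ((symTablesAn1S2 3 Lc cΛ').M j ρ w)) ν y')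
              * perF M (GcombSh (d := 3) Lc j)
            + perF M (GcombSh (d := 3) Lc j)
              * perF M (dM (GcombSh (d := 3) Lc j) Lc (fun κ u => dper M (SpureCombOf (symTablesAn1S2 3 Lc cΛ') cE cVH cΛ j κ u))
                  (fun ρ w => dper M ((symTablesAn1S2 3 Lc cΛ').M j ρ w)) ν y')
              * perF M (GcombSh (d := 3) Lc j)
              * perF M (dM (GcombSh (d := 3) Lc j) Lc (fun κ u => dper M (SpureCombOf (symTablesAn1S2 3 Lc cΛ') cE cVH cΛ j κ u))
                  (fun ρ w => dper M ((symTablesAn1S2 3 Lc cΛ').M j ρ w)) μ y)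
              * perF M (GcombSh (d := 3) Lc j)
            - perF M (GcombSh (d := 3) Lc j)
              * perF M (W2SymOfK (GcombSh (d := 3) Lc j) Lc (fun κ u => dper M (SpureCombOf (symTablesAn1S2 3 Lc cΛ') cE cVH cΛ j κ u))
                  (fun ρ w => dper M ((symTablesAn1S2 3 Lc cΛ').M j ρ w))
                  (fun κ u κ' u' => dper M (fun x z a c => ∑' n : Site (3 + 1),
                    T2RecOf 3 Lc (GcombSh Lc) (SpureCombOf (symTablesAn1S2 3 Lc cΛ') cE cVH cΛ) (symTablesAn1S2 3 Lc cΛ').M cE₂ cB T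
                      (symTablesAn1S2 3 Lc cΛ').vh₂S (symTablesAn1S2 3 Lc cΛ').mixFF j κ u κ' (translate M u' n) x z a c))
                  (fun κ u ρ w => dper M (fun x z a c => ∑' n : Site (3 + 1),
                    M2Of 3 Lc (symTablesAn1S2 3 Lc cΛ').mixFF j κ u ρ (translate M' w n) x z a c)) μ y ν y')
              * perF M (GcombSh (d := 3) Lc j)).submatrix
            (fun a : ι => ((wrapPt M ((Lc : ℤ) • (ybar a : Site (3 + 1))), Sum.inr (m a)) : Idx M (Fib 3)))
            (fun a : ι => ((wrapPt M ((Lc : ℤ) • (ybar a : Site (3 + 1))), Sum.inr (m a)) : Idx M (Fib 3))) := by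
  ext a a'
  simp only [Matrix.submatrix_apply, Matrix.smul_apply, smul_eq_mul]
  exact perF_dper_tsum_T2comb_succ_inl_inl_an1 M cΛ' cE cVH cΛ cE₂ cB T hM j μ y ν y' (ybar a) (ybar a') (m a) (m a')

end An1Record

end Summit.QuantumFields.BalabanUV.Beta.CombHId2TorusSocket

end
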